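import Literature.NumberTheory.ComplexMultiplication.MainTheoremCMLevelQMultiplication
import Literature.NumberTheory.ComplexMultiplication.CMTypeUniformizationHoms
import Literature.NumberTheory.ComplexMultiplication.CMTypeUniformizationHomDetermined
import Literature.AlgebraicGeometry.Motives.AbelianVarietyFrobeniusCharpolyRigidity
import Literature.AlgebraicGeometry.Motives.AbelianVarietyDegreeGrowth
import Literature.AlgebraicGeometry.Motives.AbelianVarietyKernelDimension
import HarnessLib

/-!
# The degree of an `𝔞`-multiplication: `ν(λ) = N(γ𝔞𝔟⁻¹)`, and `ν(λ) = N(𝔮)` for the `𝔮`-multiplication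
# (Shimura 1998, §7.1 Prop. 7, §7.2 Prop. 10, §7.4 Prop. 15; §18.6 proof of Thm. 18.6, pp. 128–129)

Topic `Literature/NumberTheory/ComplexMultiplication`, namespace
`Literature.NumberTheory.ComplexMultiplication.CMTypeUniformization`.  KERNEL ONLY: theorems; no definition,
no named fact, no `sorry`.

For uniformisations `ξ₁ : ℂ^Φ/D(𝔞) ≃ A₁(ℂ)`, `ξ₂ : ℂ^Φ/D(𝔟) ≃ A₂(ℂ)` of structures of type `(K, Φ)` and a
homomorphism `f : A₁ → A₂` inducing Shimura's `S(γ)` (`f(ξ₁ x) = ξ₂(S(γ) x)`, `γ ∈ 𝔞⁻¹𝔟`, `γ ≠ 0`; e.g. the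
`𝔮`-multiplication `λ : A → A_i` of the proof of Thm. 18.6, `γ = 1`, `𝔟 = 𝔮⁻¹𝔞`):

* §1 **the kernel on complex points**: `Ker f (ℂ) = ξ₁(Ker S(γ))`, so `#Ker f (ℂ) = #Ker S(γ) = N(γ𝔞𝔟⁻¹)`
  (`natCard_kerPoints_eq_absNorm`; [Shimura1998] §7.4 proof of Prop. 15 «`Ker(λ)` corresponds to
  `D(γ⁻¹𝔟)/D(𝔞)`» with §7.2 Prop. 10, the tree's `CMTypeLattice.natCard_ker_mulHom`);
* §2 **`f` is an isogeny and `ν(f) = deg f = N(γ𝔞𝔟⁻¹)`** for the ALGEBRAIC degree `Hom.kerRank f = dim Γ(Ker f, 𝒪)`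
  (`isIsogeny_of_map_r_eq_mul`, `kerRank_eq_absNorm_of_map_r_eq_mul`; [Shimura1998] §7.1 Prop. 7 «an
  `𝔞`-multiplication is an isogeny», §7.2 Prop. 10 «`ν(λ_𝔞) = N(𝔞)^m`», `m = 1` for a CM type).  PROOF (no
  separability of `f` is used): with `N = N(γ𝔞𝔟⁻¹)` and `δ = N/γ ∈ 𝔟⁻¹𝔞` the `S(δ)`-multiplication `g : A₂ → A₁`
  ([Shimura1998] §7.4 Prop. 15, tree `exists_hom_forall_map_r_eq`) has `f ≫ g = N • 𝟙` (`comp_eq_nsmul_of_map_r_eq_mul`),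
  so `f`, `g` are isogenies with `deg f · deg g = deg [N] = N^{2 dim} = N^{[K:ℚ]} = N(γ𝔞𝔟⁻¹)·N(δ𝔟𝔞⁻¹) =
  #Ker f(ℂ) · #Ker g(ℂ)`, while `#Ker(ℂ) ≤ deg` for each (tree `natCard_kerPoints_le_kerRank`); hence equality.
* §3 **`k`-models** (`k ⊆ ℂ`, base-change uniformisations `ξ`, `η` of `(A ⊗ ℂ, ι ⊗ ℂ)`, `(B ⊗ ℂ, ι ⊗ ℂ)`, the shape of the
  tree's `exists_qMultiplication`): for `λ : A ⟶ B` over `k` with `λ_ℂ(ξ.r u) = η.r u` and `𝔮𝔟 = 𝔞`,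
  **`λ` is an isogeny** WITHOUT any rationality hypothesis (`isIsogeny_of_map_baseChange_r_eq'`, removing the
  hypothesis `hBA` of the tree's `isIsogeny_of_map_baseChange_r_eq`: surjectivity descends from `λ ⊗ ℂ`, and a
  surjective homomorphism between abelian varieties of equal dimension is an isogeny) and
  **`deg λ = Hom.kerRank λ = N(𝔮)`** (`kerRank_eq_absNorm_of_map_baseChange_r_eq`; [Shimura1998] p. 129:
  «`ν(λ̃) = ν(λ) = N(𝔮)`», the degree the height-one argument compares with `ν(π) = pⁿ`).

NOT HERE (recorded for the cell `hodgecm-mathlib`, E2 road for F-S2′): the same statements for the `k`-SHAPE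
uniformisations `CMTypeUniformization Φ 𝔞 A ιA` of the named fact `shimuraTaniyamaPair_degOne'` taken literally
need the transport «an analytification of `A₀` is an analytification of `A₀ ⊗_k ℂ`» (the converse of the tree's
`IsAnalytification.pointsEquiv_symm_comp`), which the tree does not have; the fact's ONLY consumer
(`exists_hom_iso_redHom_comp_eq_relFrobenius_of_pair_degOne'`) instantiates it with `ofBaseChange ξ`,
`ofBaseChange η`, i.e. with the base-change shapes treated here.

## References
* [Shimura1998] G. Shimura, *Abelian Varieties with Complex Multiplication and Modular Functions*, Princeton
  Univ. Press 1998: §7.1 Prop. 7 and Prop. 9 (pp. 50–51), §7.2 Prop. 10 (p. 53), §7.4 Prop. 15 (p. 58),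
  §18.6 proof of Thm. 18.6 (pp. 128–129).
* [MumfordAV1970] D. Mumford, *Abelian Varieties*, §19 Thm. 4 and Remark p. 169 (degree of an isogeny).
-/

set_option autoImplicit false

noncomputable section

open CategoryTheory NumberField
open scoped NumberField nonZeroDivisors Classical

namespace Literature.NumberTheory.ComplexMultiplication

open Literature.AlgebraicGeometry.Motives (CMType AbelianVariety AlgPoints specOver)
open Literature.AlgebraicGeometry.Motives.AbelianVariety
open Literature.Geometry.Kaehler
open Literature.Geometry.Kaehler.ComplexTorus (cover mapMatrix)
open CMTypeLattice
open FractionalIdeal (spanSingleton)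
open _root_.AlgebraicGeometry

namespace CMTypeUniformization

/-! ## §0 Arithmetic plumbing -/

section Arith

/-- Sandwich for natural numbers: `a ≤ x`, `b ≤ y`, `x y = a b`, `a, b > 0` force `x = a`. [folklore] -/
private theorem eq_of_le_of_le_of_mul_eq {a b x y : ℕ} (ha : a ≤ x) (hb : b ≤ y) (h : x * y = a * b)
    (hb0 : 0 < b) : x = a := by
  refine le_antisymm ?_ ha
  have h1 : x * b ≤ a * b := by
    calc x * b ≤ x * y := Nat.mul_le_mul_left x hb
      _ = a * b := h
  exact Nat.le_of_mul_le_mul_right h1 hb0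

variable {K : Type} [Field K] [NumberField K]

/-- `N((N)) = N^{[K : ℚ]}` for a natural number `N`. [folklore] -/
private theorem absNorm_span_natCast' (N : ℕ) :
    Ideal.absNorm (Ideal.span {(N : 𝓞 K)}) = N ^ Module.finrank ℚ K := by
  rw [Ideal.absNorm_span_natCast, NumberField.RingOfIntegers.rank]

end Arith

/-! ## §1 The kernel of an `S(γ)`-multiplication on complex points -/

section Complex

variable {K : Type} [Field K] [NumberField K] {Φ : CMType K} {𝔞 𝔟 : (FractionalIdeal (𝓞 K)⁰ K)ˣ}
  {A₁ A₂ : AbelianVariety ℂ} {ι₁ : 𝓞 K →+* End A₁} {ι₂ : 𝓞 K →+* End A₂}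
  (ξ₁ : CMTypeUniformization Φ 𝔞 A₁ ι₁) (ξ₂ : CMTypeUniformization Φ 𝔟 A₂ ι₂)

/-- **`ξ₁ x ∈ Ker f (ℂ) ↔ x ∈ Ker S(γ)`** when `f` induces `S(γ)` on the uniformisations («`Ker(λ)` corresponds to
`D(γ⁻¹𝔟)/D(𝔞)`»: `ξ₂` is injective with `ξ₂(0) = 0`). [cite: Shimura1998, §7.4 Prop. 15 (proof), p. 58] -/
theorem toFun_mem_kerPoints_iff {γ : K}
    (hγ : γ ∈ ((𝔞 : FractionalIdeal (𝓞 K)⁰ K)⁻¹ * 𝔟 : FractionalIdeal (𝓞 K)⁰ K)) {f : A₁ ⟶ A₂}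
    (hf : ∀ x, AlgPoints.map f.hom.hom.hom (ξ₁.toFun x) = ξ₂.toFun (mulHom Φ hγ x))
    (x : ComplexTorus (periodIso Φ 𝔞)) :
    ξ₁.toFun x ∈ Hom.kerPoints (specOver ℂ ℂ) f ↔ x ∈ (mulHom Φ hγ).ker := by
  rw [Hom.mem_kerPoints_iff, AddMonoidHom.mem_ker, ← AlgPoints.map_apply, hf, ← ξ₂.toFun_zero,
    ξ₂.bijective.injective.eq_iff]

/-- **`#Ker f (ℂ) = #Ker S(γ)`**: `ξ₁` carries `Ker S(γ) ⊆ ℂ^Φ/D(𝔞)` bijectively onto the kernel of `f` on complex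
points. [cite: Shimura1998, §7.4 Prop. 15 (proof), p. 58] -/
theorem natCard_kerPoints_eq_natCard_ker_mulHom {γ : K}
    (hγ : γ ∈ ((𝔞 : FractionalIdeal (𝓞 K)⁰ K)⁻¹ * 𝔟 : FractionalIdeal (𝓞 K)⁰ K)) {f : A₁ ⟶ A₂}
    (hf : ∀ x, AlgPoints.map f.hom.hom.hom (ξ₁.toFun x) = ξ₂.toFun (mulHom Φ hγ x)) :
    Nat.card (Hom.kerPoints (specOver ℂ ℂ) f) = Nat.card (mulHom Φ hγ).ker := by
  symm
  refine Nat.card_congr (Equiv.ofBijective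
    (fun x : (mulHom Φ hγ).ker =>
      (⟨ξ₁.toFun x.1, (ξ₁.toFun_mem_kerPoints_iff ξ₂ hγ hf x.1).2 x.2⟩ : Hom.kerPoints (specOver ℂ ℂ) f))
    ⟨fun x y h => Subtype.ext (ξ₁.bijective.injective (congrArg Subtype.val h)), fun P => ?_⟩)
  obtain ⟨x, hx⟩ := ξ₁.bijective.surjective P.1
  have hxm : x ∈ (mulHom Φ hγ).ker := (ξ₁.toFun_mem_kerPoints_iff ξ₂ hγ hf x).1 (hx ▸ P.2)
  exact ⟨⟨x, hxm⟩, Subtype.ext hx⟩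

/-- **`#Ker f (ℂ) = N(γ𝔞𝔟⁻¹)`** for `f` inducing `S(γ)`, `γ ≠ 0` («`ν(λ_𝔞) = N(𝔞)^m`», `m = 1`; the count of
`Ker S(γ) ≅ D(γ⁻¹𝔟)/D(𝔞)` is the tree's `CMTypeLattice.natCard_ker_mulHom`).
[cite: Shimura1998, §7.2 Prop. 10, p. 53; §7.4 Prop. 15 (proof), p. 58] -/
theorem natCard_kerPoints_eq_absNorm {γ : K}
    (hγ : γ ∈ ((𝔞 : FractionalIdeal (𝓞 K)⁰ K)⁻¹ * 𝔟 : FractionalIdeal (𝓞 K)⁰ K)) (hγ0 : γ ≠ 0)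
    {𝔠 : Ideal (𝓞 K)}
    (h𝔠 : (𝔠 : FractionalIdeal (𝓞 K)⁰ K) =
      spanSingleton (𝓞 K)⁰ γ * (𝔞 : FractionalIdeal (𝓞 K)⁰ K) * (𝔟 : FractionalIdeal (𝓞 K)⁰ K)⁻¹)
    {f : A₁ ⟶ A₂} (hf : ∀ x, AlgPoints.map f.hom.hom.hom (ξ₁.toFun x) = ξ₂.toFun (mulHom Φ hγ x)) :
    Nat.card (Hom.kerPoints (specOver ℂ ℂ) f) = Ideal.absNorm 𝔠 := by
  rw [ξ₁.natCard_kerPoints_eq_natCard_ker_mulHom ξ₂ hγ hf, natCard_ker_mulHom Φ hγ hγ0 h𝔠]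

/-! ## §2 An `S(γ)`-multiplication is an isogeny of degree `N(γ𝔞𝔟⁻¹)` -/

/-- From the torsion form «`f(r₁(u)) = r₂(γu)`» to the torus form `f ∘ ξ₁ = ξ₂ ∘ S(γ)`: the homomorphism inducing
`S(γ)` ([Shimura1998] Prop. 15, tree `exists_hom_forall_map_toFun_eq_mulHom`) agrees with `f` on `r₁(K)`, hence
equals `f` (`hom_eq_of_forall_r`). [cite: Shimura1998, §7.4 Prop. 15, p. 58] -/
theorem map_toFun_eq_mulHom_of_map_r_eq_mul {γ : K}
    (hγ : γ ∈ ((𝔞 : FractionalIdeal (𝓞 K)⁰ K)⁻¹ * 𝔟 : FractionalIdeal (𝓞 K)⁰ K)) {f : A₁ ⟶ A₂}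
    (hf : ∀ u : K, AlgPoints.map f.hom.hom.hom (ξ₁.r u) = ξ₂.r (γ * u)) (x : ComplexTorus (periodIso Φ 𝔞)) :
    AlgPoints.map f.hom.hom.hom (ξ₁.toFun x) = ξ₂.toFun (mulHom Φ hγ x) := by
  obtain ⟨f', -, hf'⟩ := exists_hom_forall_map_toFun_eq_mulHom ξ₁ ξ₂ hγ
  have hff' : f = f' := ξ₁.hom_eq_of_forall_r f f' fun u => by
    rw [hf, ξ₁.r_apply, ξ₂.r_apply, hf', mulHom_cover, map_mul]
  rw [hff', hf']

/-- **`f ≫ g = N • 𝟙`** when `f` induces `S(γ)`, `g` induces `S(δ)` and `δγ = N ∈ ℕ` (both sides induce `S(N)`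
on `ξ₁`: Prop. 9 «`μλ` is an `𝔞𝔟`-multiplication», and `ι(N) = N • 𝟙`).
[cite: Shimura1998, §7.1 Prop. 9, p. 51; §7.4 Prop. 15, p. 58] -/
theorem comp_eq_nsmul_of_map_r_eq_mul {γ δ : K} {N : ℕ} (hδγ : δ * γ = N) {f : A₁ ⟶ A₂} {g : A₂ ⟶ A₁}
    (hf : ∀ u : K, AlgPoints.map f.hom.hom.hom (ξ₁.r u) = ξ₂.r (γ * u))
    (hg : ∀ u : K, AlgPoints.map g.hom.hom.hom (ξ₂.r u) = ξ₁.r (δ * u)) :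
    f ≫ g = N • 𝟙 A₁ := by
  have hN : ((N : 𝓞 K) : K) = (N : K) := by simp
  have h1 : f ≫ g = (ι₁ (N : 𝓞 K) : A₁ ⟶ A₁) := by
    refine ξ₁.hom_eq_of_forall_r _ _ fun u => ?_
    rw [map_hom_comp, hf, hg, ← mul_assoc, hδγ, ← hN, ξ₁.r_mul]
  rw [h1, map_natCast]
  exact (show ((N : ℕ) : End A₁) = N • (1 : End A₁) from (nsmul_one N).symm)

variable {γ : K} (hγ : γ ∈ ((𝔞 : FractionalIdeal (𝓞 K)⁰ K)⁻¹ * 𝔟 : FractionalIdeal (𝓞 K)⁰ K)) (hγ0 : γ ≠ 0)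
  {𝔠 : Ideal (𝓞 K)}
  (h𝔠 : (𝔠 : FractionalIdeal (𝓞 K)⁰ K) =
    spanSingleton (𝓞 K)⁰ γ * (𝔞 : FractionalIdeal (𝓞 K)⁰ K) * (𝔟 : FractionalIdeal (𝓞 K)⁰ K)⁻¹)

include h𝔠 in
/-- The partner datum: `δ := N(𝔠)/γ` lies in `𝔟⁻¹𝔞` (`N(𝔠) ∈ 𝔠 = γ𝔞𝔟⁻¹`), with `δγ = N(𝔠)`.
[cite: Shimura1998, §7.4 Prop. 15, p. 58] -/
theorem exists_partner_mem_inv_mul :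
    ∃ δ : K, δ ∈ ((𝔟 : FractionalIdeal (𝓞 K)⁰ K)⁻¹ * 𝔞 : FractionalIdeal (𝓞 K)⁰ K) ∧
      δ * γ = (Ideal.absNorm 𝔠 : ℕ) := by
  have hN : ((Ideal.absNorm 𝔠 : ℕ) : K) ∈ (𝔠 : FractionalIdeal (𝓞 K)⁰ K) := by
    rw [FractionalIdeal.mem_coeIdeal]
    exact ⟨(Ideal.absNorm 𝔠 : 𝓞 K), Ideal.absNorm_mem 𝔠, by simp⟩
  rw [h𝔠, mul_assoc, FractionalIdeal.mem_singleton_mul] at hN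
  obtain ⟨δ, hδ, hNδ⟩ := hN
  refine ⟨δ, by rwa [mul_comm] at hδ, ?_⟩
  rw [hNδ, mul_comm]

include hγ0 h𝔠 in
/-- `𝔠 = γ𝔞𝔟⁻¹ ≠ 0`, so `N(𝔠) ≠ 0`. [folklore] -/
private theorem absNorm_ne_zero : Ideal.absNorm 𝔠 ≠ 0 := by
  rw [Ne, Ideal.absNorm_eq_zero_iff]
  rintro rfl
  have h : spanSingleton (𝓞 K)⁰ γ * (𝔞 : FractionalIdeal (𝓞 K)⁰ K) * (𝔟 : FractionalIdeal (𝓞 K)⁰ K)⁻¹ = 0 := by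
    rw [← h𝔠, FractionalIdeal.coeIdeal_bot]
  rw [mul_eq_zero, mul_eq_zero, FractionalIdeal.spanSingleton_eq_zero_iff] at h
  rcases h with (h | h) | h
  · exact hγ0 h
  · exact 𝔞.ne_zero h
  · exact (inv_ne_zero 𝔟.ne_zero) h

include ξ₁ ξ₂ in
/-- `dim A₁ = dim A₂ = #Φ`. [cite: Shimura1998, §18.4 p. 126] -/
theorem dim_eq : A₁.dim = A₂.dim :=
  ξ₁.finrank_eq_dim.symm.trans ξ₂.finrank_eq_dim

include ξ₁ in
/-- `2 · dim A₁ = [K : ℚ]`. [cite: Shimura1998, §18.4 p. 126 («2 dim(A) = [K : ℚ]»)] -/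
theorem two_mul_dim_eq_finrank : 2 * A₁.dim = Module.finrank ℚ K := by
  rw [← ξ₁.finrank_eq_dim, Module.finrank_fintype_fun_eq_card, two_mul_card_eq_finrank]

include hγ0 h𝔠 in
/-- **An `S(γ)`-multiplication is an isogeny** (`γ ≠ 0`): «an `𝔞`-multiplication is an isogeny» — `f ≫ g = N • 𝟙`
with `N = N(γ𝔞𝔟⁻¹) ≠ 0` for the `S(N/γ)`-multiplication `g`, and `dim A₁ = dim A₂`.
[cite: Shimura1998, §7.1 Prop. 7, p. 50; §7.4 Prop. 15, p. 58] -/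
theorem isIsogeny_of_map_r_eq_mul {f : A₁ ⟶ A₂}
    (hf : ∀ u : K, AlgPoints.map f.hom.hom.hom (ξ₁.r u) = ξ₂.r (γ * u)) : IsIsogeny f := by
  obtain ⟨δ, hδ, hδγ⟩ := exists_partner_mem_inv_mul h𝔠
  obtain ⟨g, -, hg⟩ := exists_hom_forall_map_r_eq ξ₂ ξ₁ hδ
  have hN0 : ((Ideal.absNorm 𝔠 : ℕ) : ℂ) ≠ 0 := Nat.cast_ne_zero.2 (absNorm_ne_zero hγ0 h𝔠)
  exact isIsogeny_of_comp_eq_nsmul_id hN0 (ξ₁.comp_eq_nsmul_of_map_r_eq_mul ξ₂ hδγ hf hg) (ξ₁.dim_eq ξ₂)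

include hγ hγ0 h𝔠 in
/-- **`deg f = N(γ𝔞𝔟⁻¹)`** for the algebraic degree `Hom.kerRank f = dim Γ(Ker f, 𝒪)` of an `S(γ)`-multiplication
(«`ν(λ_𝔞) = N(𝔞)^m`», `m = 1`), by the sandwich `#Ker(ℂ) ≤ deg` for `f` and its partner `g` against
`deg f · deg g = deg [N] = N^{2 dim} = #Ker f(ℂ) · #Ker g(ℂ)`. [cite: Shimura1998, §7.2 Prop. 10, p. 53; §7.4 Prop. 15, p. 58]
[cite: MumfordAV1970, §19 Thm. 4] -/
theorem kerRank_eq_absNorm_of_map_r_eq_mul {f : A₁ ⟶ A₂}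
    (hf : ∀ u : K, AlgPoints.map f.hom.hom.hom (ξ₁.r u) = ξ₂.r (γ * u)) :
    Hom.kerRank f = Ideal.absNorm 𝔠 := by
  classical
  obtain ⟨δ, hδ, hδγ⟩ := exists_partner_mem_inv_mul h𝔠
  obtain ⟨g, -, hg⟩ := exists_hom_forall_map_r_eq ξ₂ ξ₁ hδ
  set N : ℕ := Ideal.absNorm 𝔠 with hNdef
  have hN0 : N ≠ 0 := absNorm_ne_zero hγ0 h𝔠
  have hδ0 : δ ≠ 0 := by
    intro h0
    rw [h0, zero_mul] at hδγ
    exact hN0 (by exact_mod_cast hδγ.symm)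
  -- the partner ideal `𝔠' = δ𝔟𝔞⁻¹`
  obtain ⟨𝔠', h𝔠'⟩ := exists_ideal_coe_eq_spanSingleton_mul_mul_inv hδ
  -- `f ≫ g = N • 𝟙`, `g ≫ f = N • 𝟙`
  have hfg : f ≫ g = N • 𝟙 A₁ := ξ₁.comp_eq_nsmul_of_map_r_eq_mul ξ₂ hδγ hf hg
  have hγδ : γ * δ = N := by rw [mul_comm, hδγ]
  have hgf : g ≫ f = N • 𝟙 A₂ := ξ₂.comp_eq_nsmul_of_map_r_eq_mul ξ₁ hγδ hg hf
  have hNC : ((N : ℕ) : ℂ) ≠ 0 := Nat.cast_ne_zero.2 hN0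
  have hfI : IsIsogeny f := isIsogeny_of_comp_eq_nsmul_id hNC hfg (ξ₁.dim_eq ξ₂)
  have hgI : IsIsogeny g := isIsogeny_of_comp_eq_nsmul_id hNC hgf (ξ₂.dim_eq ξ₁)
  haveI := hfI.2
  haveI := hgI.2
  -- counts on complex points
  have ha : Nat.card (Hom.kerPoints (specOver ℂ ℂ) f) = N :=
    ξ₁.natCard_kerPoints_eq_absNorm ξ₂ hγ hγ0 h𝔠 (ξ₁.map_toFun_eq_mulHom_of_map_r_eq_mul ξ₂ hγ hf)
  have hb : Nat.card (Hom.kerPoints (specOver ℂ ℂ) g) = Ideal.absNorm 𝔠' :=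
    ξ₂.natCard_kerPoints_eq_absNorm ξ₁ hδ hδ0 h𝔠' (ξ₂.map_toFun_eq_mulHom_of_map_r_eq_mul ξ₁ hδ hg)
  -- `𝔠 𝔠' = (N)`
  have hcc : 𝔠 * 𝔠' = Ideal.span {(N : 𝓞 K)} := by
    rw [← FractionalIdeal.coeIdeal_inj (K := K), FractionalIdeal.coeIdeal_mul, h𝔠, h𝔠',
      FractionalIdeal.coeIdeal_span_singleton]
    have h𝔞0 : (𝔞 : FractionalIdeal (𝓞 K)⁰ K) ≠ 0 := 𝔞.ne_zero
    have h𝔟0 : (𝔟 : FractionalIdeal (𝓞 K)⁰ K) ≠ 0 := 𝔟.ne_zero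
    calc spanSingleton (𝓞 K)⁰ γ * (𝔞 : FractionalIdeal (𝓞 K)⁰ K) * (𝔟 : FractionalIdeal (𝓞 K)⁰ K)⁻¹ *
          (spanSingleton (𝓞 K)⁰ δ * (𝔟 : FractionalIdeal (𝓞 K)⁰ K) * (𝔞 : FractionalIdeal (𝓞 K)⁰ K)⁻¹)
        = spanSingleton (𝓞 K)⁰ γ * spanSingleton (𝓞 K)⁰ δ *
            ((𝔞 : FractionalIdeal (𝓞 K)⁰ K) * (𝔞 : FractionalIdeal (𝓞 K)⁰ K)⁻¹) *
            ((𝔟 : FractionalIdeal (𝓞 K)⁰ K) * (𝔟 : FractionalIdeal (𝓞 K)⁰ K)⁻¹) := by ring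
      _ = spanSingleton (𝓞 K)⁰ ((N : 𝓞 K) : K) := by
          rw [mul_inv_cancel₀ h𝔞0, mul_inv_cancel₀ h𝔟0, mul_one, mul_one, FractionalIdeal.spanSingleton_mul_spanSingleton,
            hγδ]
          simp
  have hab : N * Ideal.absNorm 𝔠' = N ^ (2 * A₁.dim) := by
    rw [hNdef, ← map_mul, hcc, absNorm_span_natCast', ξ₁.two_mul_dim_eq_finrank]
  -- degrees
  have hxy : Hom.kerRank f * Hom.kerRank g = N ^ (2 * A₁.dim) := by
    rw [← hfI.kerRank_comp hgI, hfg, ← natCast_zsmul]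
    have h := kerRank_zsmul_id_holds A₁ (N : ℤ) (by exact_mod_cast hN0)
    rwa [Int.natAbs_natCast] at h
  have hle1 : N ≤ Hom.kerRank f := ha ▸ natCard_kerPoints_le_kerRank f ℂ
  have hle2 : Ideal.absNorm 𝔠' ≤ Hom.kerRank g := hb ▸ natCard_kerPoints_le_kerRank g ℂ
  have hb0 : 0 < Ideal.absNorm 𝔠' := by
    rw [← hb]
    haveI := finite_kerPoints_of_isFinite g ℂ
    exact Nat.card_pos
  exact eq_of_le_of_le_of_mul_eq hle1 hle2 (hxy.trans hab.symm) hb0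

/-- **The `𝔮`-multiplication over `ℂ`: `f(r₁(u)) = r₂(u)` with `𝔮𝔟 = 𝔞` is an isogeny of degree `N(𝔮)`**
(`γ = 1`, `𝔠 = 𝔞𝔟⁻¹ = 𝔮`). [cite: Shimura1998, §7.1 Prop. 7, p. 50; §18.6 proof of Thm. 18.6, pp. 128–129 («ν(λ) = N(𝔮)»)] -/
theorem isIsogeny_and_kerRank_eq_absNorm_of_map_r_eq (𝔮 : Ideal (𝓞 K))
    (h𝔮𝔟 : (𝔮 : FractionalIdeal (𝓞 K)⁰ K) * (𝔟 : FractionalIdeal (𝓞 K)⁰ K) = 𝔞) {f : A₁ ⟶ A₂}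
    (hf : ∀ u : K, AlgPoints.map f.hom.hom.hom (ξ₁.r u) = ξ₂.r u) :
    IsIsogeny f ∧ Hom.kerRank f = Ideal.absNorm 𝔮 := by
  have h1 : (1 : K) ∈ ((𝔞 : FractionalIdeal (𝓞 K)⁰ K)⁻¹ * 𝔟 : FractionalIdeal (𝓞 K)⁰ K) :=
    one_mem_inv_mul_of_coeIdeal_mul_eq 𝔞 𝔟 𝔮 h𝔮𝔟
  have h𝔠 : (𝔮 : FractionalIdeal (𝓞 K)⁰ K) =
      spanSingleton (𝓞 K)⁰ (1 : K) * (𝔞 : FractionalIdeal (𝓞 K)⁰ K) * (𝔟 : FractionalIdeal (𝓞 K)⁰ K)⁻¹ := by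
    rw [FractionalIdeal.spanSingleton_one, one_mul, ← h𝔮𝔟, mul_assoc, mul_inv_cancel₀ 𝔟.ne_zero, mul_one]
  have hf' : ∀ u : K, AlgPoints.map f.hom.hom.hom (ξ₁.r u) = ξ₂.r (1 * u) := fun u => by rw [one_mul, hf]
  exact ⟨ξ₁.isIsogeny_of_map_r_eq_mul ξ₂ one_ne_zero h𝔠 hf', ξ₁.kerRank_eq_absNorm_of_map_r_eq_mul ξ₂ h1 one_ne_zero h𝔠 hf'⟩

end Complex

/-! ## §3 `k`-models: the `𝔮`-multiplication `λ : A → A_i` over `k` is an isogeny of degree `N(𝔮)` -/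

section Model

variable {K : Type} [Field K] [NumberField K] {Φ : CMType K} {𝔞 𝔟 : (FractionalIdeal (𝓞 K)⁰ K)ˣ}
  {k : Type} [Field k] [Algebra k ℂ] {A B : AbelianVariety k} {ιA : 𝓞 K →+* End A} {ιB : 𝓞 K →+* End B}
  (ξ : CMTypeUniformization Φ 𝔞 (A.baseChange ℂ) ((endBaseChange ℂ A).comp ιA))
  (η : CMTypeUniformization Φ 𝔟 (B.baseChange ℂ) ((endBaseChange ℂ B).comp ιB))

/-- **Surjectivity descends along `k ⊆ ℂ`**: if `λ ⊗ ℂ` is surjective then so is `λ` (`(λ ⊗ ℂ) ≫ pr_B = pr_A ≫ λ` with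
`pr_B : B ⊗ ℂ → B` surjective). [cite: GortzWedhorn2020, Prop. 4.32 (surjectivity and base change)] -/
theorem surjective_of_surjective_baseChange (lam : A ⟶ B) [h : Surjective (Hom.toSchemeHom (Hom.baseChange ℂ lam))] :
    Surjective (Hom.toSchemeHom lam) := by
  have hsp : Surjective (bcSpec k ℂ) := ⟨fun x => ⟨default, Subsingleton.elim _ _⟩⟩
  have hfst : Surjective (Limits.pullback.fst B.X.hom (bcSpec k ℂ)) :=
    MorphismProperty.pullback_fst (P := @Surjective) _ _ hsp
  refine ⟨fun y => ?_⟩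
  obtain ⟨y', hy'⟩ := hfst.surj y
  obtain ⟨x', hx'⟩ := h.surj y'
  have hsq := congrArg (fun φ => φ.base x') (toSchemeHom_baseChange_comp_fst ℂ lam)
  refine ⟨(Limits.pullback.fst A.X.hom (bcSpec k ℂ)).base x', ?_⟩
  have e1 : (Hom.toSchemeHom lam).base ((Limits.pullback.fst A.X.hom (bcSpec k ℂ)).base x') =
      (Limits.pullback.fst B.X.hom (bcSpec k ℂ)).base ((Hom.toSchemeHom (Hom.baseChange ℂ lam)).base x') :=
    hsq.symm
  have e2 : (Hom.toSchemeHom (Hom.baseChange ℂ lam)).base x' = y' := hx'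
  have e3 : (Limits.pullback.fst B.X.hom (bcSpec k ℂ)).base y' = y := hy'
  rw [e2, e3] at e1
  exact e1

/-- **The `𝔮`-multiplication is an isogeny — no rationality hypothesis** ([Shimura1998] p. 128 «a homomorphism `λ` of `A`
ONTO `A_i`»; §7.1 Prop. 7): for `λ : A ⟶ B` over `k ⊆ ℂ` with `λ_ℂ(ξ.r u) = η.r u` (base-change uniformisations of types
`𝔞`, `𝔟 = 𝔮⁻¹𝔞`), `λ ⊗ ℂ` is an isogeny by §2, so `λ` is surjective of equal dimensions, hence an isogeny.  Removes the
hypothesis `hBA` of `isIsogeny_of_map_baseChange_r_eq`. [cite: Shimura1998, §18.6 proof of Thm. 18.6, p. 128; §7.1 Prop. 7, p. 50]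
[cite: GortzWedhorn2023, Prop. 27.176] -/
theorem isIsogeny_of_map_baseChange_r_eq' (𝔮 : Ideal (𝓞 K))
    (h𝔮𝔟 : (𝔮 : FractionalIdeal (𝓞 K)⁰ K) * (𝔟 : FractionalIdeal (𝓞 K)⁰ K) = 𝔞) {lam : A ⟶ B}
    (hlam : ∀ u : K, AlgPoints.map (Hom.baseChange ℂ lam).hom.hom.hom (ξ.r u) = η.r u) : IsIsogeny lam := by
  have hC := (ξ.isIsogeny_and_kerRank_eq_absNorm_of_map_r_eq η 𝔮 h𝔮𝔟 hlam).1
  haveI := hC.1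
  haveI := surjective_of_surjective_baseChange lam
  exact isIsogeny_of_surjective_of_dim_eq lam (dim_eq_of_uniformizations ξ η)

/-- **`deg λ = N(𝔮)` for the `𝔮`-multiplication `λ : A → A_i` over `k`** («`ν(λ̃) = ν(λ)` … `N(𝔮)`», p. 129; the degree
is invariant under base change, tree `IsIsogeny.kerRank_baseChange`, and over `ℂ` it is `N(𝔮)` by §2).
[cite: Shimura1998, §18.6 proof of Thm. 18.6, pp. 128–129; §7.2 Prop. 10, p. 53] -/
theorem kerRank_eq_absNorm_of_map_baseChange_r_eq (𝔮 : Ideal (𝓞 K))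
    (h𝔮𝔟 : (𝔮 : FractionalIdeal (𝓞 K)⁰ K) * (𝔟 : FractionalIdeal (𝓞 K)⁰ K) = 𝔞) {lam : A ⟶ B}
    (hlam : ∀ u : K, AlgPoints.map (Hom.baseChange ℂ lam).hom.hom.hom (ξ.r u) = η.r u) :
    Hom.kerRank lam = Ideal.absNorm 𝔮 := by
  rw [← (ξ.isIsogeny_of_map_baseChange_r_eq' η 𝔮 h𝔮𝔟 hlam).kerRank_baseChange (L := ℂ)]
  exact (ξ.isIsogeny_and_kerRank_eq_absNorm_of_map_r_eq η 𝔮 h𝔮𝔟 hlam).2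

end Model

end CMTypeUniformization

end Literature.NumberTheory.ComplexMultiplication

end
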